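import Mathlib
import HarnessLib
import Summits.NavierStokesRegularity.NavierStokesRegularity.Theses.RigidMotionDoor
import Summits.NavierStokesRegularity.NavierStokesRegularity.Theorems.RigidMotionDoorSubspaceStabilisation
import Summits.NavierStokesRegularity.NavierStokesRegularity.Theorems.RigidMotionDoorForwardRigidSymmetry

/-!
# RigidMotionDoor — crux `EuclidAccumulation` (stmt-NavierStokesRegularity-27902) BY NAME

Route `RigidMotionDoor` (ns-idea-6 LINE g5-3 «stabilisation»; planner ns-idea-6 g5, critic idea-crit-4).  The
kernel-checked composition of the birth skeleton `EuclidAccumulation_birth.lean` with its two stubs, both landed: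
`rigidMotionDoor_stub_forwardRigidSymmetry` (M, load-bearing: an infinitesimal rigid-motion symmetry of one slice
propagates to every later slice — finite motions + bounded Oseen-mild forward uniqueness) and
`rigidMotionDoor_stub_subspaceStabilisation` (S: a non-decreasing family of submodules of a finite-dimensional space
indexed by `s < 0` stabilises towards `−∞`).  The symmetry sets `V(s) ⊆ (ℝ³ →L ℝ³) × ℝ³` of the slices (pairs
`(B, e)`, `B` skew, `∂_{B y + e} v(s) − B v(s) ≡ 0`) are submodules (the condition is linear in `(B, e)`),
non-decreasing in `s` by the first stub; the second gives `s₀` with `V(s₀) ⊆ V(s)` for all `s < 0`; the hypothesis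
supplies a non-zero pitchless element of `V(s₀)`.

Prover ns-imp-p1 g4.  WHAT THIS IS NOT: `EuclidAccumulation` is the lever of a criterion door about HYPOTHETICAL
Type-I blow-up profiles; the door's zoom `RigidZoom` and `Target` are separate items; NO statement about
Navier–Stokes regularity is proved or claimed.
-/

noncomputable section

-- the summit and its single problem share the name (D-0017 nested layout)
set_option linter.dupNamespace false

namespace Summit.NavierStokesRegularity.NavierStokesRegularity.Theorems

open Set Function
open scoped RealInnerProductSpace InnerProductSpace

/-- **Crux `EuclidAccumulation` (item 27902) BY NAME**: if every slice of a profile of the route's Type-I Oseen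
class admits a non-zero pitchless Killing symmetry, then ONE non-zero pitchless Killing field is a symmetry of
EVERY slice. -/
theorem rigidMotionDoor_euclidAccumulation_proof : Theses.RigidMotionDoor.EuclidAccumulation := by
  intro C v hdecay hcont hmild hdiv hsym
  -- the symmetry submodule of the slice `v s`
  let V : ℝ → Submodule ℝ ((EuclideanSpace ℝ (Fin 3) →L[ℝ] EuclideanSpace ℝ (Fin 3)) × EuclideanSpace ℝ (Fin 3)) :=
    fun s =>
    { carrier := {p | (∀ x, ⟪p.1 x, x⟫ = 0) ∧ ∀ y, fderiv ℝ (v s) y (p.1 y + p.2) - p.1 (v s y) = 0}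
      add_mem' := by
        rintro ⟨B, e⟩ ⟨B', e'⟩ ⟨hB, hBs⟩ ⟨hB', hB's⟩
        refine ⟨fun x => ?_, fun y => ?_⟩
        · simp only [Prod.fst_add, add_apply, inner_add_left, hB x, hB' x, add_zero]
        · have h1 := hBs y
          have h2 := hB's y
          simp only [Prod.fst_add, Prod.snd_add, add_apply] at h1 h2 ⊢
          have hre : B y + B' y + (e + e') = (B y + e) + (B' y + e') := by abel
          rw [hre, map_add]
          rw [sub_eq_zero] at h1 h2 ⊢
          rw [h1, h2]
      zero_mem' := ⟨fun x => by simp, fun y => by simp⟩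
      smul_mem' := by
        rintro c ⟨B, e⟩ ⟨hB, hBs⟩
        refine ⟨fun x => ?_, fun y => ?_⟩
        · simp only [Prod.smul_fst, smul_apply, real_inner_smul_left, hB x, mul_zero]
        · have h1 := hBs y
          simp only [Prod.smul_fst, Prod.smul_snd, smul_apply] at h1 ⊢
          rw [← smul_add, map_smul, ← smul_sub, h1, smul_zero] }
  have hmemV : ∀ (s : ℝ) (p : (EuclideanSpace ℝ (Fin 3) →L[ℝ] EuclideanSpace ℝ (Fin 3)) × EuclideanSpace ℝ (Fin 3)),
      p ∈ V s ↔ (∀ x, ⟪p.1 x, x⟫ = 0) ∧ ∀ y, fderiv ℝ (v s) y (p.1 y + p.2) - p.1 (v s y) = 0 :=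
    fun s p => Iff.rfl
  have hmono : ∀ s₁ s₂ : ℝ, s₁ ≤ s₂ → s₂ < 0 → V s₁ ≤ V s₂ := by
    intro s₁ s₂ h12 h2 p hp
    rw [hmemV] at hp ⊢
    exact ⟨hp.1, RigidMotionDoorForwardRigidSymmetry.rigidMotionDoor_stub_forwardRigidSymmetry C v hdecay hcont
      hmild hdiv p.1 p.2 hp.1 s₁ s₂ h12 h2 hp.2⟩
  obtain ⟨s₀, hs₀, hstab⟩ := rigidMotionDoor_stub_subspaceStabilisation _ V hmono
  obtain ⟨B, e, hskew, hpitch, hne, hsymB⟩ := hsym s₀ hs₀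
  refine ⟨B, e, hskew, hpitch, hne, fun s hs => ?_⟩
  have hmem₀ : ((B, e) : (EuclideanSpace ℝ (Fin 3) →L[ℝ] EuclideanSpace ℝ (Fin 3)) × EuclideanSpace ℝ (Fin 3)) ∈
      V s₀ := (hmemV s₀ (B, e)).2 ⟨hskew, hsymB⟩
  exact ((hmemV s (B, e)).1 (hstab s hs hmem₀)).2

end Summit.NavierStokesRegularity.NavierStokesRegularity.Theorems

end
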